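import Mathlib
import HarnessLib
import Literature.Analysis.FluidPDE.SelfSimilar
import Literature.Analysis.FluidPDE.LocalTypeI
import Literature.Analysis.FluidPDE.VectorCalculus
import Literature.Analysis.UnboundedOperators.HeatKernel
import Literature.Analysis.FluidPDE.NSBoundedMildOseen
import Summits.NavierStokesRegularity.NavierStokesRegularity.Theorems.PoloidalWindowDoorPoloidalWindowRigidityDegenerate
import Summits.NavierStokesRegularity.NavierStokesRegularity.Theorems.PoloidalWindowDoorPoloidalWindowRigidityFlat
import Summits.NavierStokesRegularity.NavierStokesRegularity.Theorems.PoloidalWindowDoorPoloidalWindowRigidityDecayingSlopeLiouville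

/-!
# Route `PoloidalWindowDoor`, crux `PoloidalWindowRigidity` (K2, stmt-NavierStokesRegularity-19708) — the SOURCE-GAUGE STRATUM
# (CENSUS-K2G §12 Cor. A): a stream function with decaying slope and a source depending on time only forces triviality

Cell ns-regularity-ideate, K2 lead nsreg-p7 (support file, `--supports stmt-…-19708 --as helper`).  Mechanism M8 applied to the
Clebsch stream function itself: for a profile `v` of the route's Type-I class, poloidal along `e₃`, and ANY scalar `ψ`, jointly
`C²` on the open slab, whose horizontal gradient is the rotated horizontal vorticity (`(curl v)₀ = ∂₁ψ`, `(curl v)₁ = −∂₀ψ` —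
every Clebsch stream function of `…Clebsch`, in any gauge `ψ + g(x₃,t)`), IF `ψ` has decaying slope about a point
(`|ψ(t,x) − ψ(t,x₀)| ≤ ε(t)‖x − x₀‖`, `ε` continuous, `ε√(−t) → 0`; automatic for the axis gauge by `…ClebschSlope`) AND its
source `∂ₜψ + (v·∇)ψ − Δψ` is a function of `t` alone, THEN `v ≡ 0`: the decaying-slope Liouville lemma (L4,
`…DecayingSlopeLiouville.stub_decayingSlopeLiouville`) makes every slice `ψ(t,·)` constant, so `curl v ≡ 0`, and the
irrotational stratum (`…Degenerate.eq_zero_of_irrotational`) ends.  This is the sub-branch «T ≡ τ(t)» of CENSUS-K2G §5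
(β independent of `x₃`), now EMPTY in the class — kernel-checked.

* `eq_zero_of_streamSourceGauge`, `nonflatLiouville_of_streamSourceGauge`.

WHAT THIS IS NOT: not a claim about Navier–Stokes regularity and not the open residue — one more settled stratum of it
(bears_on LADDER-NS N0, rung N0-LocalTubeDoorPoloidal).
-/

noncomputable section

-- the summit and its single sub-problem share the name (CONVENTIONS §1), as in every Theorems file
set_option linter.dupNamespace false

namespace Summit.NavierStokesRegularity.NavierStokesRegularity.Theorems.PoloidalWindowDoorPoloidalWindowRigiditySourceGauge

open MeasureTheory Set Function Filter Topology TopologicalSpace Metric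
open scoped RealInnerProductSpace InnerProductSpace Laplacian
open Literature.Analysis Literature.Analysis.FluidPDE
open Summit.NavierStokesRegularity.NavierStokesRegularity.Theorems.PoloidalWindowDoorPoloidalWindowRigidityDegenerate
open Summit.NavierStokesRegularity.NavierStokesRegularity.Theorems.PoloidalWindowDoorPoloidalWindowRigidityFlat
open Summit.NavierStokesRegularity.NavierStokesRegularity.Theorems.PoloidalWindowDoorPoloidalWindowRigidityDecayingSlopeLiouville

variable {C : ℝ} {v : ℝ → EuclideanSpace ℝ (Fin 3) → EuclideanSpace ℝ (Fin 3)}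

/-- **The source-gauge stratum is empty (CENSUS-K2G §12 Cor. A).**  A profile of the route's Type-I class, poloidal along
`e₃`, admitting a `C²` stream function `ψ` (`(curl v)₀ = ∂₁ψ`, `(curl v)₁ = −∂₀ψ`) with decaying slope about some `x₀` and
with source `∂ₜψ + (v·∇)ψ − Δψ` depending on `t` only, vanishes identically. -/
theorem eq_zero_of_streamSourceGauge (hrate : HasTypeITimeDecay C v)
    (hcont : ContinuousOn (uncurry v) (Iio (0 : ℝ) ×ˢ univ))
    (hmild : ∀ s t : ℝ, s < t → t < 0 → ∀ x,
      v t x = UnboundedOperators.heatExtension (v s) (t - s) x - oseenDuhamel 1 s v v t x)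
    (hdiv : ∀ t < 0, VectorCalculus.IsDivFree (v t))
    (hpol : ∀ s < 0, ∀ y, ⟪curl (v s) y, EuclideanSpace.single 2 1⟫_ℝ = 0)
    {ψ : ℝ → EuclideanSpace ℝ (Fin 3) → ℝ} (hψ : ContDiffOn ℝ 2 (uncurry ψ) (Iio (0 : ℝ) ×ˢ univ))
    (hcurl : ∀ t < 0, ∀ y, curl (v t) y 0 = fderiv ℝ (ψ t) y (EuclideanSpace.single 1 1) ∧
      curl (v t) y 1 = -fderiv ℝ (ψ t) y (EuclideanSpace.single 0 1))
    {src : ℝ → ℝ} {x₀ : EuclideanSpace ℝ (Fin 3)} {ε : ℝ → ℝ}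
    (heq : ∀ t < 0, ∀ x, deriv (fun τ => ψ τ x) t + fderiv ℝ (ψ t) x (v t x) - (Δ (ψ t)) x = src t)
    (hslope : ∀ t < 0, ∀ x, |ψ t x - ψ t x₀| ≤ ε t * ‖x - x₀‖) (hεc : ContinuousOn ε (Iio 0))
    (hεt : Tendsto (fun t => ε t * Real.sqrt (-t)) atBot (𝓝 0)) :
    ∀ t < 0, ∀ x, v t x = 0 := by
  -- every slice of `ψ` is constant (L4)
  have hconst : ∀ t < 0, ∀ x, ψ t x = ψ t x₀ :=
    stub_decayingSlopeLiouville C v hrate hcont hmild hdiv ψ src x₀ ε hψ heq hslope hεc hεt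
  -- hence `∇(ψ t) = 0` and `curl v ≡ 0`
  have hirr : ∀ s < 0, ∀ y, curl (v s) y = 0 := by
    intro s hs y
    have hfun : ψ s = fun _ => ψ s x₀ := funext fun x => hconst s hs x
    have hD : ∀ w, fderiv ℝ (ψ s) y w = 0 := fun w => by rw [hfun]; simp
    obtain ⟨h0, h1⟩ := hcurl s hs y
    have h2 : curl (v s) y 2 = 0 := by
      have := hpol s hs y
      rwa [EuclideanSpace.inner_single_right, one_mul, conj_trivial] at this
    ext i
    fin_cases i
    · simpa [hD] using h0
    · simpa [hD] using h1
    · simpa using h2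
  exact eq_zero_of_irrotational hrate hcont hmild hdiv hirr

/-- **Stub-format corollary**: under the hypotheses of `eq_zero_of_streamSourceGauge` the apex is not backward-singular. -/
theorem nonflatLiouville_of_streamSourceGauge (hrate : HasTypeITimeDecay C v)
    (hcont : ContinuousOn (uncurry v) (Iio (0 : ℝ) ×ˢ univ))
    (hmild : ∀ s t : ℝ, s < t → t < 0 → ∀ x,
      v t x = UnboundedOperators.heatExtension (v s) (t - s) x - oseenDuhamel 1 s v v t x)
    (hdiv : ∀ t < 0, VectorCalculus.IsDivFree (v t))
    (hpol : ∀ s < 0, ∀ y, ⟪curl (v s) y, EuclideanSpace.single 2 1⟫_ℝ = 0)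
    {ψ : ℝ → EuclideanSpace ℝ (Fin 3) → ℝ} (hψ : ContDiffOn ℝ 2 (uncurry ψ) (Iio (0 : ℝ) ×ˢ univ))
    (hcurl : ∀ t < 0, ∀ y, curl (v t) y 0 = fderiv ℝ (ψ t) y (EuclideanSpace.single 1 1) ∧
      curl (v t) y 1 = -fderiv ℝ (ψ t) y (EuclideanSpace.single 0 1))
    {src : ℝ → ℝ} {x₀ : EuclideanSpace ℝ (Fin 3)} {ε : ℝ → ℝ}
    (heq : ∀ t < 0, ∀ x, deriv (fun τ => ψ τ x) t + fderiv ℝ (ψ t) x (v t x) - (Δ (ψ t)) x = src t)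
    (hslope : ∀ t < 0, ∀ x, |ψ t x - ψ t x₀| ≤ ε t * ‖x - x₀‖) (hεc : ContinuousOn ε (Iio 0))
    (hεt : Tendsto (fun t => ε t * Real.sqrt (-t)) atBot (𝓝 0)) :
    ¬ IsBackwardSingularPoint v 0 :=
  not_backwardSingular_of_zero
    (eq_zero_of_streamSourceGauge hrate hcont hmild hdiv hpol hψ hcurl heq hslope hεc hεt)

end Summit.NavierStokesRegularity.NavierStokesRegularity.Theorems.PoloidalWindowDoorPoloidalWindowRigiditySourceGauge

end
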